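import Summits.QuantumFields.YangMills.Theorems.LangevinControlUVGapToContinuumOneLegFarBound
import HarnessLib

/-!
# Crux `GapToContinuum` (stmt-QuantumFields-8896): the smeared one-leg field — far bound from ONE
# instance of `HasLatticeMassGap`

`--supports stmt-QuantumFields-8896` (route `LangevinControlUV`; line lead c10; registered sub-goal
`stub_oneLegSmearedFarBound`).  Sequel of `…OneLegFarBound` (p150813), in the crux's own vocabulary.

**`norm_osCorr_smearedLatticeField_le`.**  Let `HasLatticeMassGap r sch Δ` (`0 ≤ Δ`; per-pair constant
AND per-pair threshold, `∀ A B ∃ C ∀ᶠ k`), a species `s` and a real test function `p` supported in a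
positive time slab `lo ≤ x⁰ ≤ hi`, `0 < lo`.  With `C` the constant of the ONE pair `(Θs, s)`
(`Θs = s.timeReflect`): eventually in `k`, at every step with `0 ≤ β_k`, the renormalised smeared
lattice field `X_k = c_s(k) a_k⁴ Σ_{x ∈ box L_k} p(a_k x)(s ∘ τ_x − m_s(k))` read on the scheme's OWN odd
torus satisfies the whole-range far bound
`‖osCorr μ_k Θ₀ τ_m X_k X_k‖ ≤ (|c_s(k)| a_k⁴ Σ_x |p(a_k x)|)² · C · e^{−Δ a_k m}`
for every `m` with `2(m + 2⌊hi/a_k⌋₊) + 2R_s + 1 < L_k` (`R_s` the time radius of `s`).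

So the census's defect D2 ("per-pair thresholds vs the k-growing family of translated pairs") does
NOT bite in the ONE-LEG sector: the translated cross pairs `(τ_x s, τ_y s)` inside a smeared leg are
collapsed onto the single certified pair by reflection-positivity Cauchy–Schwarz at separations
`(0, 2n)` (`norm_osCorr_combination_le_of_nonneg`).  What remains between this bound and the one-leg
sector of `T.HasMassGap Δ` is exactly D1 (`0 ≤ β_k`, an explicit hypothesis here) and D3b (the Hankel
chain `HankelSite.norm_osCorr_negReflect_le_of_decay_lt` turns the far bound into OS currency with loss
factor `((|c_s(k)| a_k⁴ Σ|p|)² C / osVar_k X_k)^{2^{-J}}`, `2^J ≍ a_k L_k`, i.e. needs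
`log |c_s(k)| = o(a_k L_k)` — untyped in the crux).

Ingredients: torus translation bookkeeping (`torusLift_torusConfigShift`, `torusConfigShift_torusConfigShift`),
single translates of a species are slab observables (`dependsOn_translate_torusLift`), shift absorption
(`osCorr_torusTimeShift_comp_comp`), and the certified pair as the tree's `latticeConnectedCorr`
(`osCorr_species_eq_latticeConnectedCorr`); constants drop out (`osCorr_add_const`, Literature).

Refs: Osterwalder–Seiler 1978 §2; Glimm–Jaffe 1987 §6.1, §19.7. -/

open scoped ComplexConjugate ComplexOrder SchwartzMap
open Filter MeasureTheory Finset
open Literature.MathematicalPhysics.QuantumLattice Literature.MathematicalPhysics.QuantumFieldTheory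
open Summit.QuantumFields.YangMills.Cruxes.LatticeGapOnTrajectory.OrbitKantorovichFiniteSize.Transfer

noncomputable section

namespace Summit.QuantumFields.YangMills.Theorems.GapToContinuum.OneLeg

/-! ## The smeared one-leg field of a species: far bound from ONE instance of `HasLatticeMassGap` -/


section SmearGeometry

variable {G : Type} [Group G] [MeasurableSpace G] {Sd : ℕ}

/-- `Torus.proj` is additive. -/
theorem proj_add' (u v : Literature.Probability.LatticeModels.Site 4) :
    Literature.Probability.LatticeModels.Torus.proj Sd (u + v) =
      Literature.Probability.LatticeModels.Torus.proj Sd u + Literature.Probability.LatticeModels.Torus.proj Sd v := by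
  funext i; simp [Literature.Probability.LatticeModels.Torus.proj]

omit [Group G] in
/-- **Periodic lift and torus translations**: `torusLift (torusConfigShift (proj v) U) = θ_v (torusLift U)`. -/
theorem torusLift_torusConfigShift (v : Literature.Probability.LatticeModels.Site 4) (U : GaugeConfig 4 Sd G) :
    torusLift Sd (torusConfigShift (Literature.Probability.LatticeModels.Torus.proj Sd v) U) =
      configShift v (torusLift Sd U) := by
  have h := congrFun (toTorusObservable_comp_configShift Sd v (id : LGConfig 4 G → LGConfig 4 G)) U
  simpa only [toTorusObservable, Function.comp_apply, id_eq] using h.symm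

omit [Group G] in
/-- Composition of torus translations: `shift_u ∘ shift_v = shift_{u+v}`. -/
theorem torusConfigShift_torusConfigShift [NeZero Sd] (u v : Site 4 Sd) (U : GaugeConfig 4 Sd G) :
    torusConfigShift u (torusConfigShift v U) = torusConfigShift (u + v) U := by
  funext e
  simp only [torusConfigShift_apply, sub_sub]

/-- **A single translate of a species is a slab observable.** If `R + lo ≤ y⁰` and `y⁰ + R ≤ hi < Sd`
(`R` the time radius of `s`, `1 ≤ lo`), the translate `U ↦ s.F (θ_{-y} Ũ)` of the species to the
lattice point `y` depends only on the torus links based at lattice times `lo … hi`. -/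
theorem dependsOn_translate_torusLift [NeZero Sd] (s : YMSpecies G) (y : Literature.Probability.LatticeModels.Site 4) {lo hi : ℕ}
    (hlo1 : 1 ≤ lo) (hlo : (timeRadius s : ℤ) + lo ≤ y 0) (hhi : y 0 + timeRadius s ≤ hi)
    (hSd : hi < Sd) :
    DependsOn (fun U : GaugeConfig 4 Sd G => s.F (configShift (-y) (torusLift Sd U)))
      {e : Edge 4 Sd | lo ≤ (e.1 0).val ∧ (e.1 0).val ≤ hi} := by
  -- adapted from `dependsOn_smearedLatticeField_torusLift` (`SpeciesLatticeProducts`)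
  intro U V hUV
  refine s.isCylinder fun e he => ?_
  simp only [configShift_apply, torusLift, Function.comp_apply]
  refine hUV _ ?_
  have hR := abs_le.1 (abs_le_timeRadius s he)
  have hz : (lo : ℤ) ≤ (e.1 - -y) 0 ∧ (e.1 - -y) 0 ≤ hi := by
    simp only [Pi.sub_apply, Pi.neg_apply]
    constructor <;> omega
  have hw' : (hi : ℤ) < Sd := by exact_mod_cast hSd
  have hval : ((((e.1 - -y) 0 : ℤ) : ZMod Sd).val : ℤ) = (e.1 - -y) 0 := by
    rw [ZMod.val_intCast, Int.emod_eq_of_lt (by omega) (by omega)]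
  simp only [Set.mem_setOf_eq, torusEdge, Literature.Probability.LatticeModels.Torus.proj_apply]
  constructor <;> omega

end SmearGeometry


section SmearMain

variable {G : Type} [Group G] [TopologicalSpace G] [IsTopologicalGroup G] [CompactSpace G]
  [MeasurableSpace G] [BorelSpace G] {N : ℕ} (ρ : G →* Matrix (Fin N) (Fin N) ℂ) {S : ℕ}

/-- The unit time shift preserves Wilson's torus measure. -/
theorem measurePreserving_torusTimeShift (β : ℝ) (n : ℕ) :
    MeasurePreserving (⇑(torusTimeShift (G := G) (2 * S + 1) n))
      (wilsonMeasure (d := 4) (L := 2 * S + 1) ρ β) (wilsonMeasure (d := 4) (L := 2 * S + 1) ρ β) :=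
  ⟨(torusTimeShift _ _).measurable, by unfold torusTimeShift; exact wilsonMeasure_map_torusConfigShift ρ β _⟩

/-- **Shift absorption on the odd Wilson torus**: `osCorr τ_m (X ∘ τ_s) (Y ∘ τ_s') = osCorr τ_(m+s+s') X Y`
for the site reflection `Θ₀` (bounded measurability not needed: pure change of variables). -/
theorem osCorr_torusTimeShift_comp_comp (β : ℝ) {X Y : GaugeConfig 4 (2 * S + 1) G → ℂ}
    (hX : Measurable X) (hY : Measurable Y) (m s s' : ℕ) :
    osCorr (wilsonMeasure (d := 4) (L := 2 * S + 1) ρ β) GaugeConfig.negReflect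
        (torusTimeShift (2 * S + 1) m) (X ∘ torusTimeShift (2 * S + 1) s) (Y ∘ torusTimeShift (2 * S + 1) s') =
      osCorr (wilsonMeasure (d := 4) (L := 2 * S + 1) ρ β) GaugeConfig.negReflect
        (torusTimeShift (2 * S + 1) (m + s + s')) X Y := by
  have hΘm : Measurable (GaugeConfig.negReflect : GaugeConfig 4 (2 * S + 1) G → _) :=
    WilsonSiteRP.measurable_negReflect
  have hτ := measurePreserving_torusTimeShift (G := G) ρ (S := S) β 1
  set σ : GaugeConfig 4 (2 * S + 1) G → GaugeConfig 4 (2 * S + 1) G :=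
    ⇑(torusConfigShift (G := G) (Pi.single 0 (1 : ZMod (2 * S + 1)) : Site 4 (2 * S + 1))) with hσdef
  have hσ : Measurable σ := (torusConfigShift _).measurable
  have hΘτ : ∀ U : GaugeConfig 4 (2 * S + 1) G,
      torusTimeShift (2 * S + 1) 1 U.negReflect = (σ U).negReflect := by
    intro U
    rw [Hankel.coe_torusTimeShift_one]
    have h := HankelSite.torusConfigShift_negReflect_comm (G := G) (-1 : ZMod (2 * S + 1)) U
    rw [Pi.single_neg, neg_neg] at h
    exact h
  have hστ : ∀ U : GaugeConfig 4 (2 * S + 1) G, σ (torusTimeShift (2 * S + 1) 1 U) = U := by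
    intro U
    rw [Hankel.coe_torusTimeShift_one]
    exact Summit.QuantumFields.YangMills.Theorems.FiniteSusceptibilityWeakCoupling.RPCauchySchwarz.torusConfigShift_shift_neg
      (Pi.single 0 1) U
  rw [← Hankel.torusTimeShift_one_iterate m, ← Hankel.torusTimeShift_one_iterate s,
    ← Hankel.torusTimeShift_one_iterate s', ← Hankel.torusTimeShift_one_iterate (m + s + s')]
  exact osCorr_iterate_comp_iterate hΘm hτ hσ hΘτ hστ hX hY m s s'

/-- **The certified pair in OS form.** For a species `s`, the reflected time-shifted connected
autocorrelation of `U ↦ s.F(Ũ)` on the torus of side `2L+1` IS the tree's `latticeConnectedCorr` of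
the pair `(Θs, s)` (`Θs = s.timeReflect`): the reflection law `torusLift_negReflect`, the translation
law `torusLift_torusTimeShift`, and `Θ₀`-invariance of Wilson's measure for the mean. -/
theorem osCorr_species_eq_latticeConnectedCorr (hρ : Continuous ρ) (β : ℝ) (L : ℕ) (s : YMSpecies G)
    (n : ℕ) :
    osCorr (wilsonMeasure (d := 4) (L := 2 * L + 1) ρ β) GaugeConfig.negReflect
        (torusTimeShift (2 * L + 1) n) (fun U => (s.F (torusLift (2 * L + 1) U) : ℂ))
        (fun U => (s.F (torusLift (2 * L + 1) U) : ℂ)) =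
      (latticeConnectedCorr ρ β (2 * L + 1) s.timeReflect.F s.F n : ℂ) := by
  rw [osCorr_ofReal]
  unfold latticeConnectedCorr
  congr 1
  have h1 : ∀ U : GaugeConfig 4 (2 * L + 1) G,
      s.timeReflect.F (torusLift (2 * L + 1) U) = s.F (torusLift (2 * L + 1) U.negReflect) := by
    intro U
    rw [LocalGaugeObservable.timeReflect_F, torusLift_negReflect]
  have h2 : ∀ U : GaugeConfig 4 (2 * L + 1) G,
      s.F (configShift (-Pi.single 0 (n : ℤ)) (torusLift (2 * L + 1) U)) =
        s.F (torusLift (2 * L + 1) (torusTimeShift (2 * L + 1) n U)) := by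
    intro U; rw [torusLift_torusTimeShift]
  simp_rw [h1, h2]
  rw [integral_comp_negReflect_eq ρ hρ β (fun U => s.F (torusLift (2 * L + 1) U))]

/-- **The one-leg far bound from ONE instance of `HasLatticeMassGap`** (crux `GapToContinuum`,
one-leg sector; defect D2 absent).  Let `HasLatticeMassGap r sch Δ` (`0 ≤ Δ`), a species `s` (time
radius `R`) and a real test function `p` supported in the time slab `lo ≤ x⁰ ≤ hi` with `0 < lo`.
Let `C` be the per-pair constant that `HasLatticeMassGap` assigns to the ONE pair `(Θs, s)`.  Then
eventually in `k`, at every step with `0 ≤ β_k`, the renormalised smeared lattice field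
`X_k(U) = c_s(k) a_k⁴ Σ_{x ∈ box L_k} p(a_k x) (s(τ_x Ũ) − m_s(k))` on the scheme's own torus (side
`2L_k+1`) satisfies, for every time shift `m` with `2(m + 2⌊hi/a_k⌋₊) + 2R + 1 < L_k`,
`‖osCorr μ_k Θ₀ τ_m X_k X_k‖ ≤ (|c_s(k)| a_k⁴ Σ_{x ∈ box L_k} |p(a_k x)|)² · C · e^{−Δ a_k m}` —
the whole-range far bound with the constant of ONE certified pair (per-pair threshold absorbed into
"eventually"), the additive counterterm `m_s(k)` being invisible and the multiplicative one entering
only through the explicit `ℓ¹` prefactor. -/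
theorem norm_osCorr_smearedLatticeField_le (r : LatticeRep G) (sch : SpeciesScheme (YMSpecies G))
    {Δ : ℝ} (hΔ : 0 ≤ Δ) (hlat : HasLatticeMassGap r sch Δ) (s : YMSpecies G)
    {p : 𝓢(EuclideanSpace ℝ (Fin 4), ℝ)} {lo hi : ℝ} (hlo : 0 < lo)
    (hsupp : tsupport (p : EuclideanSpace ℝ (Fin 4) → ℝ) ⊆ {x | lo ≤ x 0 ∧ x 0 ≤ hi}) :
    ∃ C : ℝ, 0 ≤ C ∧ ∀ᶠ k in atTop, 0 ≤ sch.β k → ∀ m : ℕ,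
      2 * (m + 2 * ⌊hi / sch.a k⌋₊) + (2 * timeRadius s + 1) < sch.L k →
      ‖osCorr (wilsonMeasure (d := 4) (L := 2 * sch.L k + 1) r.ρ (sch.β k)) GaugeConfig.negReflect
          (torusTimeShift (2 * sch.L k + 1) m)
          (fun U => (smearedLatticeField s.F (Literature.Probability.LatticeModels.box 4 (sch.L k)) (sch.a k) (sch.c s k) (sch.m s k) p
            (torusLift (2 * sch.L k + 1) U) : ℂ))
          (fun U => (smearedLatticeField s.F (Literature.Probability.LatticeModels.box 4 (sch.L k)) (sch.a k) (sch.c s k) (sch.m s k) p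
            (torusLift (2 * sch.L k + 1) U) : ℂ))‖ ≤
        (|sch.c s k| * sch.a k ^ 4 * ∑ x ∈ Literature.Probability.LatticeModels.box 4 (sch.L k), |p (sch.a k • siteToE x)|) ^ 2 * C *
          Real.exp (-(Δ * (sch.a k * m))) := by
  -- the ONE certified pair `(Θs, s)` and its constant
  obtain ⟨C, hC⟩ := hlat s.timeReflect s
  have hC0 : 0 ≤ C := by
    obtain ⟨k, hk⟩ := hC.exists
    have h := hk (sch.L k) le_rfl 0 (Nat.zero_le _)
    simp only [CharP.cast_eq_zero, mul_zero, neg_zero, Real.exp_zero, mul_one] at h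
    exact (abs_nonneg _).trans h
  -- eventually the slab of `p` sits above the time radius of the species: `a_k (R + 1) ≤ lo`
  have ha : ∀ᶠ k in atTop, sch.a k * (timeRadius s + 1) ≤ lo := by
    have h : Tendsto (fun k => sch.a k * (timeRadius s + 1)) atTop (nhds (0 * (timeRadius s + 1))) :=
      sch.tendsto_a.mul_const _
    rw [zero_mul] at h
    exact (h.eventually (Iio_mem_nhds hlo)).mono fun k hk => hk.le
  refine ⟨C, hC0, ?_⟩
  filter_upwards [hC, ha] with k hk hak
  intro hβ m hrange
  -- abbreviations
  set L := sch.L k with hL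
  set a := sch.a k with haa
  set c := sch.c s k with hc
  set mr := sch.m s k with hmr
  set R := timeRadius s with hR
  have ha0 : 0 < a := sch.a_pos k
  set μ := wilsonMeasure (d := 4) (L := 2 * L + 1) (G := G) r.ρ (sch.β k) with hμ
  haveI := isProbabilityMeasure_wilsonMeasure (d := 4) (L := 2 * L + 1) r.ρ r.continuous (sch.β k)
  have hΘ : MeasurePreserving (GaugeConfig.negReflect : GaugeConfig 4 (2 * L + 1) G → _) μ μ :=
    measurePreserving_negReflect_wilsonMeasure r.ρ r.continuous (sch.β k)
  have hτm : MeasurePreserving (⇑(torusTimeShift (G := G) (2 * L + 1) m)) μ μ :=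
    measurePreserving_torusTimeShift r.ρ (sch.β k) m
  obtain ⟨Bs, hBs⟩ := s.bounded
  -- the translates of the species and the coefficients
  set Ox : Literature.Probability.LatticeModels.Site 4 → GaugeConfig 4 (2 * L + 1) G → ℂ :=
    fun x U => (s.F (configShift (-x) (torusLift (2 * L + 1) U)) : ℂ) with hOx
  set coef : Literature.Probability.LatticeModels.Site 4 → ℂ :=
    fun x => ((c * a ^ 4 * p (a • siteToE x) : ℝ) : ℂ) with hcoef
  have hOxm : ∀ x, Measurable (Ox x) := fun x =>
    Complex.measurable_ofReal.comp (s.measurable.comp ((configShift _).measurable.comp (measurable_torusLift _)))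
  have hOxb : ∀ x U, ‖Ox x U‖ ≤ Bs := fun x U => by
    simp only [hOx, Complex.norm_real, Real.norm_eq_abs]; exact hBs _
  -- the smeared field is the combination plus a constant
  set κ0 : ℂ := ((-(c * a ^ 4 * mr * ∑ x ∈ Literature.Probability.LatticeModels.box 4 L, p (a • siteToE x)) : ℝ) : ℂ) with hκ0
  have hdecomp : (fun U => (smearedLatticeField s.F (Literature.Probability.LatticeModels.box 4 L) a c mr p (torusLift (2 * L + 1) U) : ℂ)) =
      (∑ x ∈ Literature.Probability.LatticeModels.box 4 L, coef x • Ox x) + fun _ => κ0 := by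
    funext U
    simp only [Pi.add_apply, Finset.sum_apply, Pi.smul_apply, smul_eq_mul, hcoef, hOx, hκ0,
      smearedLatticeField]
    push_cast
    rw [Finset.mul_sum, Finset.mul_sum, ← Finset.sum_neg_distrib, ← Finset.sum_add_distrib]
    refine Finset.sum_congr rfl fun x _ => ?_
    ring
  -- the combination `Y` and the constant
  set Y : GaugeConfig 4 (2 * L + 1) G → ℂ := ∑ x ∈ Literature.Probability.LatticeModels.box 4 L, coef x • Ox x
    with hY
  have hcoefb : ∀ x, ∃ B', ∀ U, ‖(coef x • Ox x) U‖ ≤ B' := fun x =>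
    ⟨‖coef x‖ * Bs, fun U => by
      rw [Pi.smul_apply, smul_eq_mul, norm_mul]
      exact mul_le_mul_of_nonneg_left (hOxb x U) (norm_nonneg _)⟩
  have hYm : Measurable Y := measurable_finset_sum_fun _ fun x _ => (hOxm x).const_smul (coef x)
  have hYb : ∃ B', ∀ U, ‖Y U‖ ≤ B' := exists_bound_sum _ fun x _ => hcoefb x
  rw [hdecomp, osCorr_add_const hΘ hτm hYm hYb hYm hYb]
  -- only the lattice points under the support of `p` contribute
  set t := (Literature.Probability.LatticeModels.box 4 L).filter (fun x => p (a • siteToE x) ≠ 0) with ht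
  have hYt : Y = ∑ x ∈ t, coef x • Ox x := by
    rw [hY, ht, Finset.sum_filter_of_ne]
    intro x _ hne hpx
    apply hne
    have : coef x = 0 := by simp [hcoef, hpx]
    rw [this, zero_smul]
  -- geometry of the contributing points: `R + 1 ≤ x⁰ ≤ hi / a`
  have hxt : ∀ x ∈ t, (R : ℤ) + 1 ≤ x 0 ∧ ((x 0).toNat : ℝ) ≤ hi / a ∧ ((x 0).toNat : ℤ) = x 0 := by
    intro x hx
    have hpx : p (a • siteToE x) ≠ 0 := (Finset.mem_filter.1 hx).2
    have hx' := hsupp (subset_tsupport _ (Function.mem_support.2 hpx))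
    simp only [Set.mem_setOf_eq, PiLp.smul_apply, siteToE_apply, smul_eq_mul] at hx'
    have h1 : (R : ℝ) + 1 ≤ (x 0 : ℝ) := le_of_mul_le_mul_left (by nlinarith [hx'.1, hak]) ha0
    have h1' : (R : ℤ) + 1 ≤ x 0 := by exact_mod_cast h1
    have h0 : 0 ≤ x 0 := by omega
    have h3 : ((x 0).toNat : ℤ) = x 0 := Int.toNat_of_nonneg h0
    refine ⟨h1', ?_, h3⟩
    rw [le_div_iff₀ ha0]
    have h4 : ((x 0).toNat : ℝ) = (x 0 : ℝ) := by exact_mod_cast h3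
    rw [h4]; nlinarith [hx'.2]
  -- time offsets, spatial parts, and the base observable shifted into the positive slab
  set sx : Literature.Probability.LatticeModels.Site 4 → ℕ := fun x => (x 0).toNat - (R + 1) with hsx
  set vx : Literature.Probability.LatticeModels.Site 4 → Site 4 (2 * L + 1) :=
    fun x => Literature.Probability.LatticeModels.Torus.proj (2 * L + 1) (-(x - Pi.single 0 (x 0))) with hvx
  set O' : GaugeConfig 4 (2 * L + 1) G → ℂ :=
    fun U => (s.F (configShift (-Pi.single 0 ((R + 1 : ℕ) : ℤ)) (torusLift (2 * L + 1) U)) : ℂ) with hO'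
  have hsxZ : ∀ x ∈ t, ((sx x : ℕ) : ℤ) = x 0 - (R + 1) := by
    intro x hx
    obtain ⟨h1, -, h3⟩ := hxt x hx
    have hle : R + 1 ≤ (x 0).toNat := by omega
    simp only [hsx, Nat.cast_sub hle, h3]
    push_cast; ring
  have hOx_eq : ∀ x ∈ t,
      Ox x = O' ∘ torusConfigShift (vx x) ∘ torusTimeShift (2 * L + 1) (sx x) := by
    intro x hx
    have hz := hsxZ x hx
    have hvec : -Pi.single (0 : Fin 4) (((R + 1 : ℕ) : ℤ)) +
        (-(x - Pi.single 0 (x 0)) + -Pi.single (0 : Fin 4) ((sx x : ℕ) : ℤ)) = -x := by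
      funext i
      by_cases hi : i = 0
      · subst hi
        simp only [Pi.add_apply, Pi.neg_apply, Pi.sub_apply, Pi.single_eq_same, hz]
        push_cast; ring
      · simp only [Pi.add_apply, Pi.neg_apply, Pi.sub_apply, Pi.single_eq_of_ne hi]
        ring
    funext U
    simp only [hOx, hO', hvx, Function.comp_apply]
    unfold torusTimeShift
    rw [torusConfigShift_torusConfigShift, ← proj_add', torusLift_torusConfigShift]
    have hcc : ∀ (u v : Literature.Probability.LatticeModels.Site 4) (W : LGConfig 4 G),
        configShift u (configShift v W) = configShift (u + v) W := fun u v W => by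
      funext e; simp only [configShift_apply, sub_sub]
    rw [hcc, hvec]
  have hYt' : Y = ∑ x ∈ t, coef x • (O' ∘ torusConfigShift (vx x) ∘ torusTimeShift (2 * L + 1) (sx x)) := by
    rw [hYt]
    exact Finset.sum_congr rfl fun x hx => by rw [hOx_eq x hx]
  -- hypotheses of the combination lemma
  have hO'm : Measurable O' :=
    Complex.measurable_ofReal.comp (s.measurable.comp ((configShift _).measurable.comp (measurable_torusLift _)))
  have hO'b : ∃ B', ∀ U, ‖O' U‖ ≤ B' := ⟨Bs, fun U => by
    simp only [hO', Complex.norm_real, Real.norm_eq_abs]; exact hBs _⟩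
  have hRL : R < L := by omega
  have hO'd : DependsOn O' {e : Edge 4 (2 * L + 1) | 1 ≤ (e.1 0).val ∧ (e.1 0).val ≤ 2 * R + 1} := by
    have h := dependsOn_translate_torusLift (Sd := 2 * L + 1) s (Pi.single 0 ((R + 1 : ℕ) : ℤ))
      (lo := 1) (hi := 2 * R + 1) le_rfl (by simp [← hR]) (by simp [← hR]; omega) (by omega)
    exact fun U V hUV => congrArg (fun z : ℝ => (z : ℂ)) (h hUV)
  have hv : ∀ x ∈ t, vx x 0 = 0 := by
    intro x _
    simp [hvx]
  have hs : ∀ x ∈ t, sx x ≤ ⌊hi / a⌋₊ := by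
    intro x hx
    obtain ⟨-, h2, -⟩ := hxt x hx
    exact (Nat.sub_le _ _).trans (Nat.le_floor h2)
  have hκ : 0 ≤ Δ * a := mul_nonneg hΔ ha0.le
  have hOc : Measurable fun U : GaugeConfig 4 (2 * L + 1) G => (s.F (torusLift (2 * L + 1) U) : ℂ) :=
    Complex.measurable_ofReal.comp (s.measurable.comp (measurable_torusLift _))
  have hO'eq : O' = (fun U => (s.F (torusLift (2 * L + 1) U) : ℂ)) ∘ torusTimeShift (2 * L + 1) (R + 1) := by
    funext U
    simp only [hO', Function.comp_apply, torusLift_torusTimeShift, Nat.cast_add, Nat.cast_one]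
  have hpair : ∀ n, n ≤ 2 * (m + 2 * ⌊hi / a⌋₊) →
      ‖osCorr μ GaugeConfig.negReflect (torusTimeShift (2 * L + 1) n) O' O'‖ ≤
        C * Real.exp (-(Δ * a * n)) := by
    intro n hn
    rw [hO'eq, osCorr_torusTimeShift_comp_comp r.ρ (sch.β k) hOc hOc n (R + 1) (R + 1),
      osCorr_species_eq_latticeConnectedCorr r.ρ r.continuous (sch.β k) L s, Complex.norm_real,
      Real.norm_eq_abs]
    refine (hk L le_rfl _ (by omega)).trans (mul_le_mul_of_nonneg_left ?_ hC0)
    rw [Real.exp_le_exp]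
    have : (Δ * a) * n ≤ Δ * (a * ((n + (R + 1) + (R + 1) : ℕ) : ℝ)) := by
      rw [← mul_assoc]; push_cast
      nlinarith [Nat.cast_nonneg (α := ℝ) R, Nat.cast_nonneg (α := ℝ) n]
    linarith
  -- the combination lemma for the ONE base observable `O'`
  have hmain := norm_osCorr_combination_le_of_nonneg r.ρ r.continuous hβ hO'm hO'b hO'd t coef vx hv sx
    hs hC0 hκ (m := m) (by omega) hpair
  rw [← hYt'] at hmain
  refine hmain.trans ?_
  -- the `ℓ¹` mass of the coefficients
  have hcoef_le : ∑ x ∈ t, ‖coef x‖ ≤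
      |c| * a ^ 4 * ∑ x ∈ Literature.Probability.LatticeModels.box 4 L, |p (a • siteToE x)| := by
    calc ∑ x ∈ t, ‖coef x‖ ≤ ∑ x ∈ Literature.Probability.LatticeModels.box 4 L, ‖coef x‖ :=
          Finset.sum_le_sum_of_subset_of_nonneg (Finset.filter_subset _ _) fun _ _ _ => norm_nonneg _
      _ = |c| * a ^ 4 * ∑ x ∈ Literature.Probability.LatticeModels.box 4 L, |p (a • siteToE x)| := by
          rw [Finset.mul_sum]
          refine Finset.sum_congr rfl fun x _ => ?_
          simp only [hcoef, Complex.norm_real, Real.norm_eq_abs, abs_mul, abs_pow, abs_of_pos ha0]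
  have hsum0 : 0 ≤ ∑ x ∈ t, ‖coef x‖ := Finset.sum_nonneg fun _ _ => norm_nonneg _
  have hexp : Real.exp (-(Δ * a * m)) = Real.exp (-(Δ * (a * m))) := by rw [mul_assoc]
  rw [hexp]
  gcongr

end SmearMain

section Stub

variable {G : Type} [Group G] [TopologicalSpace G] [IsTopologicalGroup G] [CompactSpace G]
  [MeasurableSpace G] [BorelSpace G]

/-- **Registered sub-goal `stub_oneLegSmearedFarBound`** of crux `GapToContinuum` (line lead c10): the
statement of `norm_osCorr_smearedLatticeField_le`, verbatim as registered on the item. -/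
theorem stub_oneLegSmearedFarBound :
    ∀ {G : Type} [Group G] [TopologicalSpace G] [IsTopologicalGroup G] [CompactSpace G] [MeasurableSpace G]
      [BorelSpace G] (r : LatticeRep G) (sch : SpeciesScheme (YMSpecies G)) {Δ : ℝ}, 0 ≤ Δ →
      HasLatticeMassGap r sch Δ → ∀ (s : YMSpecies G) {p : 𝓢(EuclideanSpace ℝ (Fin 4), ℝ)} {lo hi : ℝ},
      0 < lo → tsupport (p : EuclideanSpace ℝ (Fin 4) → ℝ) ⊆ {x | lo ≤ x 0 ∧ x 0 ≤ hi} →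
      ∃ C : ℝ, 0 ≤ C ∧ ∀ᶠ k in atTop, 0 ≤ sch.β k → ∀ m : ℕ,
        2 * (m + 2 * ⌊hi / sch.a k⌋₊) + (2 * timeRadius s + 1) < sch.L k →
        ‖osCorr (wilsonMeasure (d := 4) (L := 2 * sch.L k + 1) r.ρ (sch.β k)) GaugeConfig.negReflect
            (torusTimeShift (2 * sch.L k + 1) m)
            (fun U => (smearedLatticeField s.F (Literature.Probability.LatticeModels.box 4 (sch.L k)) (sch.a k)
              (sch.c s k) (sch.m s k) p (torusLift (2 * sch.L k + 1) U) : ℂ))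
            (fun U => (smearedLatticeField s.F (Literature.Probability.LatticeModels.box 4 (sch.L k)) (sch.a k)
              (sch.c s k) (sch.m s k) p (torusLift (2 * sch.L k + 1) U) : ℂ))‖ ≤
          (|sch.c s k| * sch.a k ^ 4 *
              ∑ x ∈ Literature.Probability.LatticeModels.box 4 (sch.L k), |p (sch.a k • siteToE x)|) ^ 2 * C *
            Real.exp (-(Δ * (sch.a k * m))) := by
  intro G _ _ _ _ _ _ r sch Δ hΔ hlat s p lo hi hlo hsupp
  exact norm_osCorr_smearedLatticeField_le r sch hΔ hlat s hlo hsupp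

end Stub

end Summit.QuantumFields.YangMills.Theorems.GapToContinuum.OneLeg

end
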